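import Mathlib
import Summits.NavierStokesRegularity.NavierStokesRegularity.Theorems.TaoLadderRungTwoBreakBlowupRigidityOneUpperClock
import HarnessLib

/-!
# THE WAKE PROFILE: every shell of an exact cascade flow has a TERMINAL ENERGY `w_k = lim_{t↑T} ‖x_k(t)‖²` at the
  blow-up time, `Σ_k w_k ≤ E₀`, and the ESCAPING ENERGY `e_∞ = E₀ - Σ_k w_k ≥ 0` is well defined — support for
  `stub_eternalFromBlowup` of K2(1) `TaoLadderRungTwoBreak.BlowupRigidityOne` (stmt-NavierStokesRegularity-20206)

MODEL lattice ODEs only (Tao 2016 §4 (4.3), Lemma 4.1 (4.5), (4.9)–(4.10), (4.12)); nothing here is a statement about the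
Navier–Stokes equations; NO item is closed (`--supports stmt-NavierStokesRegularity-20206`). General `m`; DEF-FREE.

By the per-shell energy balance (`shellEnergy_hasDerivWithinAt`: `d/dt ‖x_k‖² = f_{k-1} - f_k`, flux
`f_k = 2Λ^k ⟪x_{k+1}, A x_k⟫`) and the energy bound `‖x_j‖ ≤ √E₀`, each shell energy is LIPSCHITZ on `[0,T)` with constant
`2 C_A E₀^{3/2} (Λ^{k-1} + Λ^k)`; hence it has a limit at the (finite) blow-up time:
* `abs_flux_le` — `|f_k(t)| ≤ 2 C_A Λ^k E₀^{3/2}`;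
* `tendsto_shellEnergy_left` — `‖x_k(t)‖² → w_k ≥ 0` as `t ↑ T`, for every shell `k ∈ ℕ` (the shell VECTOR need not
  converge — it may rotate under the intra-shell field `Q` — but its energy does);
* `exists_wakeProfile` — the WAKE PROFILE `w : ℕ → ℝ≥0` of the flow: `w` summable, `Σ_k w_k ≤ E₀`; the deficit
  `e_∞ := E₀ - Σ_k w_k ≥ 0` is the energy that ESCAPES TO INFINITY at the blow-up;
* `wakeProfile_of_noGlobalCascade` — the package along the maximal exact flow of every robust blow-up.

READING for ⟨20206⟩. The route's heuristics are phrased in this vocabulary («a front with per-hop retention `μ` sheds the wake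
fraction `r = 1 - μ` per shell», kit j280208: `r ≈ ε²` on the Toda member): for an asymptotically DSS front with `μ < 1` one
expects `w_k ≈ r μ^k E₀` and `e_∞ = 0` — ALL the energy stays in the wake and the head blows up with vanishing absolute energy;
(S₁)-survival (`stub_eternalFromBlowup`) is the statement `μ ≥ (1+ε₀)⁻¹` about the PEAKS (`SurvivalPeaks`), not about `w`.
HONEST LABEL: existence of the limits only; no rate, no lower bound on `w_k` or `e_∞`; no stub, crux or summit is proved; rung 0.
-/

noncomputable section

-- the summit and its single sub-problem share the name (CONVENTIONS §1)
set_option linter.dupNamespace false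

open Set Filter Topology MeasureTheory
open scoped RealInnerProductSpace

namespace Summit.NavierStokesRegularity.NavierStokesRegularity.Theorems

namespace BlowupRigidityOne

open Literature.Analysis.FluidPDE Literature.Analysis.FluidPDE.TaoCascade

variable {m : ℕ}

/-- **Flux bound**: `|2 Λ^k ⟪x_{k+1}(t), A x_k(t)⟫| ≤ 2 C_A Λ^k E₀^{3/2}` along an exact flow from the one-shell datum
(cancelling table, `E₀ = Σ X₀ᵢ²`), for every `k ∈ ℤ`. [cite: Tao2016AveragedNS, §4 (4.3), Lemma 4.1 (4.9)–(4.10)] -/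
theorem abs_flux_le {ε₀ T : ℝ} (hε : 0 < ε₀)
    {α : Fin m → Fin m → Fin m → ℤ × ℤ × ℤ → ℝ} (hc : IsCancellingCoeff α)
    {X : Fin m → ℤ → ℝ → ℝ} {X₀ : Fin m → ℝ}
    (hder : ∀ i k, ∀ t ∈ Ico 0 T, HasDerivWithinAt (X i k) (quadTerm ε₀ α X i k t) (Ici 0) t)
    (hinit : ∀ i k, X i k 0 = if k = 0 then X₀ i else 0)
    (hlow : ∀ i k t, k < 0 → X i k t = 0)
    (hreg : ∀ T' : ℝ, T' < T → ∃ M : ℝ, ∀ t ∈ Icc 0 T', ∀ (i : Fin m) (k : ℤ),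
      (1 + (1 + ε₀) ^ ((10 : ℝ) * k)) * |X i k t| ≤ M)
    (k : ℤ) : ∀ t ∈ Ico 0 T,
      |2 * bigLam ε₀ ^ k * ⟪shellVec X (k + 1) t, tableA α (shellVec X k t)⟫| ≤
        2 * fluxConst α * bigLam ε₀ ^ k * Real.sqrt (∑ i, X₀ i ^ 2) ^ 3 := by
  intro t ht
  have hL : 0 < bigLam ε₀ := bigLam_pos (by linarith)
  have hS := table_sTable α hc
  set D : ℝ := Real.sqrt (∑ i, X₀ i ^ 2) with hD
  have hD0 : 0 ≤ D := Real.sqrt_nonneg _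
  have h1 := norm_shellVec_le_sqrt_datumEnergy hε hc hder hinit hlow hreg k t ht
  have h2 := norm_shellVec_le_sqrt_datumEnergy hε hc hder hinit hlow hreg (k + 1) t ht
  have hinner : |⟪shellVec X (k + 1) t, tableA α (shellVec X k t)⟫| ≤ D * (fluxConst α * D ^ 2) := by
    calc |⟪shellVec X (k + 1) t, tableA α (shellVec X k t)⟫|
        ≤ ‖shellVec X (k + 1) t‖ * ‖tableA α (shellVec X k t)‖ := abs_real_inner_le_norm _ _
      _ ≤ D * (fluxConst α * ‖shellVec X k t‖ ^ 2) :=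
          mul_le_mul h2 (hS.normA _) (norm_nonneg _) hD0
      _ ≤ D * (fluxConst α * D ^ 2) := by
          refine mul_le_mul_of_nonneg_left ?_ hD0
          exact mul_le_mul_of_nonneg_left (pow_le_pow_left₀ (norm_nonneg _) h1 2) (fluxConst_nonneg α)
  rw [abs_mul, abs_of_pos (by positivity : (0:ℝ) < 2 * bigLam ε₀ ^ k)]
  calc 2 * bigLam ε₀ ^ k * |⟪shellVec X (k + 1) t, tableA α (shellVec X k t)⟫|
      ≤ 2 * bigLam ε₀ ^ k * (D * (fluxConst α * D ^ 2)) := mul_le_mul_of_nonneg_left hinner (by positivity)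
    _ = 2 * fluxConst α * bigLam ε₀ ^ k * D ^ 3 := by ring

/-- **TERMINAL SHELL ENERGY.** Along an exact flow on `[0,T)` (`T > 0`) from the one-shell datum (cancelling table), every
shell energy `‖x_k(t)‖²` (`k ∈ ℕ`) has a limit `w_k ≥ 0` as `t ↑ T` (Lipschitz on `[0,T)` by the flux bound).
[cite: Tao2016AveragedNS, §4 (4.3), Lemma 4.1 (4.5), (4.9)–(4.10), (4.12)] -/
theorem tendsto_shellEnergy_left {ε₀ T : ℝ} (hε : 0 < ε₀) (hT : 0 < T)
    {α : Fin m → Fin m → Fin m → ℤ × ℤ × ℤ → ℝ} (hc : IsCancellingCoeff α)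
    {X : Fin m → ℤ → ℝ → ℝ} {X₀ : Fin m → ℝ}
    (hder : ∀ i k, ∀ t ∈ Ico 0 T, HasDerivWithinAt (X i k) (quadTerm ε₀ α X i k t) (Ici 0) t)
    (hinit : ∀ i k, X i k 0 = if k = 0 then X₀ i else 0)
    (hlow : ∀ i k t, k < 0 → X i k t = 0)
    (hreg : ∀ T' : ℝ, T' < T → ∃ M : ℝ, ∀ t ∈ Icc 0 T', ∀ (i : Fin m) (k : ℤ),
      (1 + (1 + ε₀) ^ ((10 : ℝ) * k)) * |X i k t| ≤ M)
    (k : ℕ) : ∃ w : ℝ, 0 ≤ w ∧ w ≤ ∑ i, X₀ i ^ 2 ∧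
      Tendsto (fun t => ‖shellVec X (k : ℤ) t‖ ^ 2) (𝓝[<] T) (𝓝 w) := by
  have hL : 0 < bigLam ε₀ := bigLam_pos (by linarith)
  have hCA : 0 ≤ fluxConst α := fluxConst_nonneg α
  set E₀ : ℝ := ∑ i, X₀ i ^ 2 with hE₀
  set D : ℝ := Real.sqrt E₀ with hD
  have hD0 : 0 ≤ D := Real.sqrt_nonneg _
  set g : ℝ → ℝ := fun t => ‖shellVec X (k : ℤ) t‖ ^ 2 with hg
  -- the derivative of `g` within `[0,∞)` and its bound
  set g' : ℝ → ℝ := fun t => 2 * bigLam ε₀ ^ ((k : ℤ) - 1) * ⟪shellVec X (k : ℤ) t, tableA α (shellVec X ((k : ℤ) - 1) t)⟫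
      - 2 * bigLam ε₀ ^ (k : ℤ) * ⟪shellVec X ((k : ℤ) + 1) t, tableA α (shellVec X (k : ℤ) t)⟫ with hg'
  have hgder : ∀ t ∈ Ico (0:ℝ) T, HasDerivWithinAt g (g' t) (Ici 0) t := fun t ht =>
    shellEnergy_hasDerivWithinAt hε hc fun i => hder i (k : ℤ) t ht
  set L : ℝ := 2 * fluxConst α * bigLam ε₀ ^ ((k : ℤ) - 1) * D ^ 3 + 2 * fluxConst α * bigLam ε₀ ^ (k : ℤ) * D ^ 3
    with hLdef
  have hL0 : 0 ≤ L := by positivity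
  have hg'le : ∀ t ∈ Ico (0:ℝ) T, |g' t| ≤ L := by
    intro t ht
    have h1 := abs_flux_le hε hc hder hinit hlow hreg ((k : ℤ) - 1) t ht
    rw [sub_add_cancel] at h1
    have h2 := abs_flux_le hε hc hder hinit hlow hreg (k : ℤ) t ht
    calc |g' t| ≤ |2 * bigLam ε₀ ^ ((k : ℤ) - 1) * ⟪shellVec X (k : ℤ) t, tableA α (shellVec X ((k : ℤ) - 1) t)⟫|
          + |2 * bigLam ε₀ ^ (k : ℤ) * ⟪shellVec X ((k : ℤ) + 1) t, tableA α (shellVec X (k : ℤ) t)⟫| :=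
          abs_sub _ _
      _ ≤ L := by rw [hLdef]; exact add_le_add h1 h2
  -- `h = g + L·t` is monotone on `[0,T)`
  have hcx : ContinuousOn (fun t => shellVec X (k : ℤ) t) (Ico 0 T) := by
    have hcp : ContinuousOn (fun s => fun i => X i (k : ℤ) s) (Ico 0 T) :=
      continuousOn_pi.2 fun i s hs => ((hder i _ s hs).continuousWithinAt).mono fun x hx => hx.1
    exact (PiLp.continuous_toLp 2 (fun _ : Fin m => ℝ)).comp_continuousOn hcp
  have hgc : ContinuousOn g (Ico 0 T) := (hcx.norm).pow 2
  set h : ℝ → ℝ := fun t => g t + L * t with hh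
  have hhc : ContinuousOn h (Ico 0 T) := hgc.add (continuousOn_const.mul continuousOn_id)
  have hmono : MonotoneOn h (Ico 0 T) := by
    refine monotoneOn_of_hasDerivWithinAt_nonneg (convex_Ico 0 T) hhc (f' := fun t => g' t + L) ?_ ?_
    · intro x hx
      rw [interior_Ico] at hx ⊢
      have hxd : HasDerivAt g (g' x) x := (hgder x ⟨hx.1.le, hx.2⟩).hasDerivAt (Ici_mem_nhds hx.1)
      have hid : HasDerivAt (fun t => L * t) L x := by
        simpa using (hasDerivAt_id x).const_mul L
      exact (hxd.add hid).hasDerivWithinAt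
    · intro x hx
      rw [interior_Ico] at hx
      have := hg'le x ⟨hx.1.le, hx.2⟩
      linarith [neg_abs_le (g' x)]
  -- bounded above on `(0,T)` by `E₀ + L T`
  have hgE : ∀ t ∈ Ico (0:ℝ) T, g t ≤ E₀ := fun t ht => by
    have h1 := norm_shellVec_le_sqrt_datumEnergy hε hc hder hinit hlow hreg (k : ℤ) t ht
    have hE00 : 0 ≤ E₀ := Finset.sum_nonneg fun i _ => sq_nonneg _
    calc g t = ‖shellVec X (k : ℤ) t‖ ^ 2 := rfl
      _ ≤ D ^ 2 := pow_le_pow_left₀ (norm_nonneg _) h1 2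
      _ = E₀ := Real.sq_sqrt hE00
  have hbdd : BddAbove (h '' Ioo 0 T) := by
    refine ⟨E₀ + L * T, ?_⟩
    rintro _ ⟨t, ht, rfl⟩
    have := hgE t ⟨ht.1.le, ht.2⟩
    have : L * t ≤ L * T := mul_le_mul_of_nonneg_left ht.2.le hL0
    show g t + L * t ≤ E₀ + L * T
    linarith
  have hlim : Tendsto h (𝓝[<] T) (𝓝 (sSup (h '' Ioo 0 T))) :=
    MonotoneOn.tendsto_nhdsWithin_Ioo_left (nonempty_Ioo.2 hT) (hmono.mono Ioo_subset_Ico_self) hbdd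
  -- subtract the linear part
  have hlin : Tendsto (fun t => L * t) (𝓝[<] T) (𝓝 (L * T)) :=
    ((continuous_const.mul continuous_id).tendsto T).mono_left nhdsWithin_le_nhds
  have hglim : Tendsto g (𝓝[<] T) (𝓝 (sSup (h '' Ioo 0 T) - L * T)) := by
    have := hlim.sub hlin
    refine this.congr fun t => ?_
    show g t + L * t - L * t = g t
    ring
  refine ⟨sSup (h '' Ioo 0 T) - L * T, ?_, ?_, hglim⟩
  · -- `g ≥ 0` eventually
    refine ge_of_tendsto hglim (Eventually.of_forall fun t => ?_)
    show 0 ≤ g t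
    positivity
  · -- `g ≤ E₀` on `[0,T)`, which is eventually true in `𝓝[<] T`
    refine le_of_tendsto hglim ?_
    have hmem : Ico 0 T ∈ 𝓝[<] T := by
      rw [mem_nhdsWithin]
      exact ⟨Ioi 0, isOpen_Ioi, hT, fun x hx => ⟨hx.1.le, hx.2⟩⟩
    exact Filter.mem_of_superset hmem fun t ht => hgE t ht

/-- **THE WAKE PROFILE AND THE ESCAPING ENERGY.** Along an exact flow on `[0,T)` (`T > 0`) from the one-shell datum
(cancelling table, `E₀ = Σ X₀ᵢ²`) there is `w : ℕ → ℝ`, `w_k = lim_{t↑T} ‖x_k(t)‖² ≥ 0`, with `w` SUMMABLE and `Σ_k w_k ≤ E₀`;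
the deficit `E₀ - Σ_k w_k ≥ 0` is the energy escaping to infinity at time `T`.
[cite: Tao2016AveragedNS, §4 (4.3), Lemma 4.1 (4.5), (4.9)–(4.10), (4.12)] -/
theorem exists_wakeProfile {ε₀ T : ℝ} (hε : 0 < ε₀) (hT : 0 < T)
    {α : Fin m → Fin m → Fin m → ℤ × ℤ × ℤ → ℝ} (hc : IsCancellingCoeff α)
    {X : Fin m → ℤ → ℝ → ℝ} {X₀ : Fin m → ℝ}
    (hder : ∀ i k, ∀ t ∈ Ico 0 T, HasDerivWithinAt (X i k) (quadTerm ε₀ α X i k t) (Ici 0) t)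
    (hinit : ∀ i k, X i k 0 = if k = 0 then X₀ i else 0)
    (hlow : ∀ i k t, k < 0 → X i k t = 0)
    (hreg : ∀ T' : ℝ, T' < T → ∃ M : ℝ, ∀ t ∈ Icc 0 T', ∀ (i : Fin m) (k : ℤ),
      (1 + (1 + ε₀) ^ ((10 : ℝ) * k)) * |X i k t| ≤ M) :
    ∃ w : ℕ → ℝ, (∀ k, 0 ≤ w k) ∧
      (∀ k : ℕ, Tendsto (fun t => ‖shellVec X (k : ℤ) t‖ ^ 2) (𝓝[<] T) (𝓝 (w k))) ∧
      (∀ K : ℕ, ∑ k ∈ Finset.range (K + 1), w k ≤ ∑ i, X₀ i ^ 2) ∧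
      Summable w ∧ ∑' k, w k ≤ ∑ i, X₀ i ^ 2 := by
  choose w hw0 _ hwt using fun k => tendsto_shellEnergy_left hε hT hc hder hinit hlow hreg k
  have hmem : Ico 0 T ∈ 𝓝[<] T := by
    rw [mem_nhdsWithin]
    exact ⟨Ioi 0, isOpen_Ioi, hT, fun x hx => ⟨hx.1.le, hx.2⟩⟩
  haveI : (𝓝[<] T).NeBot := nhdsLT_neBot T
  have hpartial : ∀ K : ℕ, ∑ k ∈ Finset.range (K + 1), w k ≤ ∑ i, X₀ i ^ 2 := by
    intro K
    have hsum : Tendsto (fun t => ∑ k ∈ Finset.range (K + 1), ‖shellVec X (k : ℤ) t‖ ^ 2) (𝓝[<] T)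
        (𝓝 (∑ k ∈ Finset.range (K + 1), w k)) :=
      tendsto_finsetSum _ fun k _ => hwt k
    refine le_of_tendsto hsum (Filter.mem_of_superset hmem fun t ht => ?_)
    exact partialEnergy_le_datumEnergy hε hc hder hinit hlow hreg t ht K
  have hpartial' : ∀ K : ℕ, ∑ k ∈ Finset.range K, w k ≤ ∑ i, X₀ i ^ 2 := by
    intro K
    rcases K with _ | K
    · simp only [Finset.range_zero, Finset.sum_empty]
      exact Finset.sum_nonneg fun i _ => sq_nonneg _
    · exact hpartial K
  have hsumm : Summable w := summable_of_sum_range_le hw0 hpartial'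
  exact ⟨w, hw0, hwt, hpartial, hsumm, hsumm.tsum_le_of_sum_range_le hpartial'⟩

/-! ### Along a robust blow-up -/

/-- **THE WAKE PROFILE OF A ROBUST BLOW-UP.** If `NoGlobalCascade ε₀ α X₀` (`ε₀ > 0`, `α ∈ E₂(R)`, any `m`), the maximal exact
cascade flow from the one-shell datum on `[0,T⋆)` (`criticalBlowup_of_noGlobalCascade`) has terminal shell energies
`w_k = lim_{t↑T⋆}‖x_k(t)‖² ≥ 0`, summable with `Σ_k w_k ≤ E₀` (escaping energy `E₀ - Σ_k w_k ≥ 0`).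
[cite: Tao2016AveragedNS, §4 Thm. 4.2 (statement shape), (4.3), Lemma 4.1 (4.5), (4.9)–(4.10), (4.12)] -/
theorem wakeProfile_of_noGlobalCascade {ε₀ R : ℝ} (hε : 0 < ε₀)
    {α : Fin m → Fin m → Fin m → ℤ × ℤ × ℤ → ℝ} {X₀ : Fin m → ℝ} (hα : InTableClass R α)
    (hNG : NoGlobalCascade ε₀ α X₀) :
    ∃ (T : ℝ) (X : Fin m → ℤ → ℝ → ℝ) (w : ℕ → ℝ), 0 < T ∧
      (∀ i n, ContDiffOn ℝ 1 (X i n) (Set.Ico 0 T)) ∧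
      (∀ i n, X i n 0 = if n = 0 then X₀ i else 0) ∧
      (∀ i n t, n < 0 → X i n t = 0) ∧
      (∀ i n t, 0 ≤ t → t < T → derivWithin (X i n) (Set.Ici 0) t = quadTerm ε₀ α X i n t) ∧
      (∀ L : ℝ, ∃ t : ℝ, 0 ≤ t ∧ t < T ∧
        ∃ (i : Fin m) (k : ℤ), L < (1 + ε₀) ^ ((5 : ℝ) * k / 2) * |X i k t|) ∧
      (∀ k, 0 ≤ w k) ∧
      (∀ k : ℕ, Tendsto (fun t => ‖shellVec X (k : ℤ) t‖ ^ 2) (𝓝[<] T) (𝓝 (w k))) ∧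
      Summable w ∧ ∑' k, w k ≤ ∑ i, X₀ i ^ 2 := by
  obtain ⟨T, X, hT, h1, h2, h3, h4, h5, h6⟩ := criticalBlowup_of_noGlobalCascade hε hα hNG
  have hder : ∀ i k, ∀ τ ∈ Ico (0 : ℝ) T,
      HasDerivWithinAt (X i k) (quadTerm ε₀ α X i k τ) (Ici 0) τ := by
    intro i k τ hτ
    have hd : DifferentiableWithinAt ℝ (X i k) (Ico 0 T) τ :=
      ((h1 i k).differentiableOn one_ne_zero) τ hτ
    have hd' : DifferentiableWithinAt ℝ (X i k) (Ici 0) τ :=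
      hd.mono_of_mem_nhdsWithin (by
        rw [mem_nhdsWithin]
        exact ⟨Iio T, isOpen_Iio, hτ.2, fun x hx => ⟨hx.2, hx.1⟩⟩)
    rw [← h4 i k τ hτ.1 hτ.2]
    exact hd'.hasDerivWithinAt
  have hreg : ∀ T' : ℝ, T' < T → ∃ M : ℝ, ∀ τ ∈ Icc (0 : ℝ) T', ∀ (i : Fin m) (k : ℤ),
      (1 + (1 + ε₀) ^ ((10 : ℝ) * k)) * |X i k τ| ≤ M := by
    intro T' hT'
    rcases le_or_gt T' 0 with h0 | h0
    · obtain ⟨M, hM⟩ := h5 (T / 2) (by linarith) (by linarith)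
      exact ⟨M, fun τ hτ i k => hM τ hτ.1 (by linarith [hτ.2]) i k⟩
    · obtain ⟨M, hM⟩ := h5 T' h0 hT'
      exact ⟨M, fun τ hτ i k => hM τ hτ.1 hτ.2 i k⟩
  obtain ⟨w, hw0, hwt, -, hsumm, htsum⟩ := exists_wakeProfile hε hT hα.2.1 hder h2 h3 hreg
  exact ⟨T, X, w, hT, h1, h2, h3, h4, h6, hw0, hwt, hsumm, htsum⟩

end BlowupRigidityOne

end Summit.NavierStokesRegularity.NavierStokesRegularity.Theorems

end
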